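import Mathlib
import Literature.MathematicalPhysics.QuantumFieldTheory.Balaban1983to89.B6Geometry
import Literature.MathematicalPhysics.QuantumFieldTheory.Balaban1983to89.B9Eq395Transport

/-!
# `Balaban1983to89.B9SectCDistCompare` — B9 Sect. C pp. 408–411, 422 with [4] = B6 (2.46) p. 231: COMPARISON OF
TWO MULTISCALE DISTANCES (the □-local one of the sequence {Ω_n(□)} and the global one of {Ω_j}) reduced to ONE
combinatorial hypothesis `BondCover m` on the graphs of admissible bonds; the Lipschitz comparison
d₂ ≦ m·d₁ KERNEL-CHECKED [folklore], delivered in the exact shape of the hypothesis `hdist` (c := 1/m) of the tree's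
`B9Eq395Transport.localizedExp_transport`

CITATION HEADER (lean-in-tree rule 2026-08-18).  Paper sub-cell `b2b-balaban-b09` (gen 10, journal claim
`B9-SECTC-DISTCOMPARE`, cell pub-balaban) on T. Bałaban, *Propagators for lattice gauge theories in a background
field*, Commun. Math. Phys. **99** (1985) 389–434 [`Balaban1985BackgroundPropagators`] (= B9; journal page = PDF
page + 388), pp. 408, 409, 411, 422 [PDF 20, 21, 23, 34] (renders `b2b-balaban-ref1/pages/1985-cmp99-background-
propagators/…-p020-x2.png`, `…-p021-x2.png`, `…-p023-x2.png`, `…-p034-x2.png`, READ AS IMAGES by this unit), with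
[4] = T. Bałaban, *Propagators and renormalization transformations for lattice gauge theories. II*, Commun. Math.
Phys. **96** (1984) 223–250 [`Balaban1984PropagatorsII`] (= B6) p. 231 [PDF 9] (render `…/1984-cmp96-propagators-
rt-II/…-p009-x2.png`, read as an image).  Imports the siblings `…Balaban1983to89.B6Geometry` (pv08: the typed
distance (2.46) = graph distance of the graph of admissible bonds, `ContourSystem`, and its CARRIER-FREE form
`RealizedBy dist G ι` with `dist_nonneg/dist_comm/dist_triangle/exp_le_260`) and — for the one glued edge of §4
only — the consumer `…Balaban1983to89.B9Eq395Transport` (b09 gen 7: `localizedExp_transport`, the transport of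
(2.85)-shaped majorants from the local block lattice 𝔅(□) to 𝔅); nothing landed is edited.  §§1–3 are stated over
raw carriers (`dist₁ : S₁ → S₁ → ℝ`, …), so that they apply verbatim with `dist₁ := g₁.dist`, `dist₂ := g₂.dist` for
`g₁ g₂ : B9.Geometry` (§4) and equally on the B6/B10/B11 carriers.

WHAT IS PRINTED (verbatim).
* B6 p. 231, the multiscale distance: *"For an arbitrary contour Γ on the lattice T_η we put |Γ| = nη, where n is a
  number of bonds the contour Γ consists of. We will define a new distance between two points of 𝔅. We consider a
  special class of contours Γ. They have the property that a part of Γ contained in B^j(Λ_j) consists of bonds of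
  the lattice Λ_j. Now we define d(y, y′) = inf_{Γ_{y,y′}} Σ_{j=0}^k (L^jη)^{−1}|Γ_{y,y′} ∩ B^j(Λ_j)|, y, y′ ∈ 𝔅, (2.46)
  where the infimum is taken over all admissible contours described above, with end-points, y, y′."*
* B9 p. 408, the LOCAL sequence: *"Let us take a cube □ ∈ 𝒟_j, and let us define a sequence {Ω_n(□)}_{n=0,…,j+1} of
  domains in the following way. The cube □̃³ is either contained in B^j(Λ_j), or intersects also the domain
  B^{j+1}(Λ_{j+1}). Let us assume the second case, then we defined Ω_{j+1}(□) = □̃³ ∩ B^{j+1}(Λ_{j+1}). We take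
  Ω_j(□) = □̃⁴, Ω_{j−1}(□) is a cube with a center at the center of □ and dist(Ω_{j−1}(□)^c, Ω_j(□)) = 2R₀M₀L^{j−1}η,
  and generally Ω_n(□) is a cube with a center at the center of □ and dist(Ω_n(□)^c, Ω_{n+1}(□)) = 2R₀M₀L^nη"* …
  *"This sequence satisfies the conditions (2.1), (2.2) with j instead of k, if rescaled from η-lattice to
  L^{−j}-lattice."*
* B9 p. 409: *"the sequence {Ω_n(□)} satisfies the assumptions of Corollary 3.6. The operators constructed for this
  sequence, which we denote by G′_□(U), C_□(U) = (Q′(U)G′²_□(U)Q′*(U))^{−1}, G_□(U), satisfy all the inequalities of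
  Theorems 3.1–3.3 correspondingly. This is the basis of all estimates for the expansions we will construct. The
  arguments will be almost identical to those in [4], so we will sketch them rather briefly. We will elaborate only
  the points which are different from the corresponding ones in [4]."*; (3.89): *"|(K(h_□)G′_□h_□λ)(x)| ≦
  O(M^{−1})e^{−δ₀(L^jη)^{−1}|y−y′|}|λ| (3.89) for x ∈ Δ(y), supp λ ⊂ Δ(y′), y, y′ ∈ □ ∈ 𝒟_j. It is exactly the bound
  (2.44) of [4], rescaled to η-scale."*
* B9 p. 411, after (3.95)/(3.96): *"The series is convergent in the weighted supremum norm on 𝔅 appearing in the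
  inequality (3.48) in Theorem 3.2."*
* B9 p. 422: *"The operators (QGQ*)^{−1}, or (QG₁Q*)^{−1}, can be analyzed in the same way as the operator
  (Q′G′²Q′*)^{−1}. We will not repeat these considerations here, let us write only bounds. We have
  |(QGQ*)^{−1}(y, y′)| ≦ O(1)(L^jη)^{−2}(L^{j′}η)^{−d}e^{−δ₁d(y,y′)} for y ∈ Λ_j, y′ ∈ Λ_{j′}, (3.132)"*.

THE POINT BEING TYPED (cell GAPS.md C-B9-54 / DIVERGENCE.md D-b09.38).  The local operators C_□ = h-localized inverses
for the sequence {Ω_n(□)} obey Theorem 3.2 for THAT sequence (p. 409), i.e. with the multiscale distance d_□ of (2.46)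
built from the local zones {Λ_n(□)}; the expansions (3.95)/(3.96) and the final bounds (3.132) are read *"on 𝔅"* in
the weighted norm of (3.48), i.e. with the GLOBAL distance d of {Ω_j}.  Passing from the one to the other uses — and
print never states — a comparison d_□(a, b) ≧ c·d(y, y′) on the agreement region of the two block lattices (the tree's
`B9Eq395Transport.localizedExp_transport`, hypothesis `hdist : ∀ a b y y', e₁ a = e₂ y → e₁ b = e₂ y' →
c * g₂.dist y y' ≤ g₁.dist a b`; cell record r1 `QGQ-walk-proof.md` (H-geo′)(h)).  By the dictionary of `…B6Geometry`
((2.46) = the graph distance `SimpleGraph.dist` of the graph of admissible bonds, `RealizedBy dist G ι`), such a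
comparison is a statement about TWO GRAPHS on (possibly different) point sets and a map φ between them, and it
follows from the purely combinatorial
  `BondCover G₁ G₂ φ m`: every admissible bond {u, v} of the first system is covered by an admissible contour of the
  second system joining φu to φv with at most m bonds,
by pushing a minimising contour of the first system bond-by-bond (`BondCover.exists_walk`, `BondCover.dist_le`:
d₂(φu, φv) ≦ m·d₁(u, v)).  WHICH φ and WHICH m hold between Bałaban's □-local and global contour systems is NOT
printed and is NOT asserted here: it is the ONE NAMED HYPOTHESIS `hcov : BondCover …` of §2–§3 (with the reachability
of the block points in the local bond graph, `hreach`, = B6 p. 231 *"Of course the infimum is attained at some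
contour"*, and the compatibility `hcompat` of φ with the two embeddings e₁, e₂ of the block lattices into the common
index set) — to be discharged by whoever types the two contour systems on one torus (cell DIVERGENCE.md D-b09.38
records the expected instance under the repaired reading R-∩ of the local sequence, Ω_n(□) := C_n(□) ∩ Ω_n: local
zone ≦ global zone pointwise, φ = the block-centre map y ↦ y^{j(y)} of B6 p. 231, m = 1 on bonds inside one global
zone and m = O(dL) on bonds meeting a surface Σ_j; none of this enters the kernel).
WHAT IS KERNEL-CHECKED (zero sorry; every item [folklore] graph theory or bookkeeping over `RealizedBy`).
§1 `BondCover` and its calculus: `mono`, `of_le` (anti/monotone in the two graphs), `bondCover_one_of_adj_or_eq`,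
   `bondCover_one_of_hom`, `bondCover_id`, `comp` (constants multiply); `exists_walk` (a contour of n bonds is covered
   by one of ≦ m·n bonds), `reachable`, `dist_le` (d₂(φu, φv) ≦ m·d₁(u, v) for reachable u, v), `dist_le_of_connected`;
   and the companion potential bounds `dist_map_le_mul_length` / `dist_map_le_mul_dist` (a map into a metric space
   stretching every bond by ≦ K stretches the end-points of an n-bond contour by ≦ K·n, hence graph distance by ≦ K·d —
   the shape of the first inequality of B6 (2.48), d ≧ scaled euclidean length, for a contour inside one zone).
§2 carrier-free site level over `B6Geometry.RealizedBy`: `dist_le_mul_of_bondCover` (d₂(y, y′) ≦ m·d₁(a, b) whenever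
   φ ι₁ a = ι₂ y, φ ι₁ b = ι₂ y′), `inv_mul_dist_le_of_bondCover` ((1/m)·d₂(y, y′) ≦ d₁(a, b); m = 0 by d₁ ≧ 0),
   `dist_le_of_bondCover_one` (m = 1: d₂ ≦ d₁).
§3 `hdist_of_bondCover`: LITERALLY the type of the binder `hdist` of `B9Eq395Transport.localizedExp_transport` with
   c := (m : ℝ)⁻¹ (and `dist₁ := g₁.dist`, `dist₂ := g₂.dist`), from `RealizedBy`×2 + `BondCover` + `hreach` +
   `hcompat`; `hdist_of_bondCover_connected` (the `G₁.Connected` form matching `…B6Geometry`'s hypotheses); and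
   `inv_nat_nonneg` (0 ≦ 1/m, the sign condition the consumer's rate lemma needs).
§4 THE GLUED EDGE `localizedExp_transport_of_bondCover`: `B9Eq395Transport.localizedExp_transport` with its metric
   hypothesis `hdist` DISCHARGED by §3 — from the (2.85)-shaped majorant 1_S(b)·Θ·e^{−ρδ₀d_□(a,b)} of an operator A
   on ℝ^{𝔅(□)} to the majorant 1_{S′}(y′)·Θ·e^{−(1/m)ρδ₀d(y,y′)} of its realisation-and-compression on ℝ^{𝔅}, the
   remaining hypotheses being the two `RealizedBy`, `BondCover … m`, `hreach`, `hcompat`, the embeddings' injectivity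
   and the support transport `hS` of the consumer (all of the printed flavour; none asserted).
WHAT IS *NOT* ASSERTED: any property of Bałaban's cubes, zones, surfaces or lattices; the instance of `BondCover`
(above); the estimates (3.89), (3.95)–(3.96), (3.132) or any operator.  NOTHING of the series is asserted; value =
typed vocabulary + kernel-checked bookkeeping, NOT summit progress (NOT continuum, NOT Clay).  Unit
`b2b-balaban-b09-g10`; cell records GAPS.md C-B9-54, DIVERGENCE.md D-b09.38.
-/

namespace Literature.MathematicalPhysics.QuantumFieldTheory.Balaban1983to89.B9SectCDistCompare

open Literature.MathematicalPhysics.QuantumFieldTheory.Balaban1983to89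

/-! ## §1  Graph level: bond covers and the Lipschitz comparison of two graph distances [folklore] -/

section Graph

variable {V₁ V₂ V₃ : Type*} (G₁ : SimpleGraph V₁) (G₂ : SimpleGraph V₂) (φ : V₁ → V₂) (m : ℕ)

/-- **Bond cover.** Every admissible bond {u, v} of the first contour system is covered by an admissible contour of
the second system from φu to φv with at most `m` bonds (in the typing of `…B6Geometry`: bonds = edges, contours =
walks). This is the ONE combinatorial input of the distance comparison — a HYPOTHESIS SHAPE (like `RealizedBy`),
never asserted: no instance is claimed in this file (the expected Bałaban instance is a cell DIVERGENCE record).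
[folklore] -/
structure BondCover : Prop where
  /-- every bond of `G₁` is covered by a `G₂`-walk of length ≤ m between the images of its end-points -/
  cover : ∀ ⦃u v : V₁⦄, G₁.Adj u v → ∃ q : G₂.Walk (φ u) (φ v), q.length ≤ m

variable {G₁ G₂ φ m}

/-- A bond cover with constant m is one with any larger constant. [folklore] -/
theorem BondCover.mono {m' : ℕ} (h : BondCover G₁ G₂ φ m) (hm : m ≤ m') : BondCover G₁ G₂ φ m' :=
  ⟨fun _ _ huv => by
    obtain ⟨q, hq⟩ := h.cover huv
    exact ⟨q, hq.trans hm⟩⟩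

/-- Bond covers are inherited by subgraphs of the source and supergraphs of the target. [folklore] -/
theorem BondCover.of_le {G₁' : SimpleGraph V₁} {G₂' : SimpleGraph V₂} (h : BondCover G₁ G₂ φ m)
    (h₁ : G₁' ≤ G₁) (h₂ : G₂ ≤ G₂') : BondCover G₁' G₂' φ m :=
  ⟨fun _ _ huv => by
    obtain ⟨q, hq⟩ := h.cover (h₁ huv)
    exact ⟨q.transfer G₂' fun e he => SimpleGraph.edgeSet_subset_edgeSet.mpr h₂ (q.edges_subset_edgeSet he),
      by rwa [SimpleGraph.Walk.length_transfer]⟩⟩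

/-- If every bond is mapped to a point or to a bond, the cover constant is 1 (the case of a contour system mapped
INTO another one, e.g. inside one zone). [folklore] -/
theorem bondCover_one_of_adj_or_eq (h : ∀ ⦃u v : V₁⦄, G₁.Adj u v → φ u = φ v ∨ G₂.Adj (φ u) (φ v)) :
    BondCover G₁ G₂ φ 1 := by
  refine ⟨fun u v huv => ?_⟩
  rcases h huv with h0 | h1
  · exact ⟨(SimpleGraph.Walk.nil : G₂.Walk (φ u) (φ u)).copy rfl h0, by simp⟩
  · exact ⟨SimpleGraph.Walk.cons h1 SimpleGraph.Walk.nil, by simp⟩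

/-- A graph homomorphism is a bond cover with constant 1. [folklore] -/
theorem bondCover_one_of_hom (f : G₁ →g G₂) : BondCover G₁ G₂ f 1 :=
  bondCover_one_of_adj_or_eq fun _ _ huv => Or.inr (f.map_adj huv)

/-- The identity is a bond cover with constant 1. [folklore] -/
theorem bondCover_id : BondCover G₁ G₁ id 1 :=
  bondCover_one_of_adj_or_eq fun _ _ huv => Or.inr huv

/-- **Contour transport.** Under a bond cover with constant m, a contour of n bonds from u to v in the first system
is covered by a contour of at most m·n bonds from φu to φv in the second. [folklore] -/
theorem BondCover.exists_walk (h : BondCover G₁ G₂ φ m) {u v : V₁} (p : G₁.Walk u v) :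
    ∃ q : G₂.Walk (φ u) (φ v), q.length ≤ m * p.length := by
  induction p with
  | nil => exact ⟨SimpleGraph.Walk.nil, by simp⟩
  | @cons a b c hab p ih =>
    obtain ⟨q₁, hq₁⟩ := h.cover hab
    obtain ⟨q₂, hq₂⟩ := ih
    refine ⟨q₁.append q₂, ?_⟩
    rw [SimpleGraph.Walk.length_append, SimpleGraph.Walk.length_cons]
    calc q₁.length + q₂.length ≤ m + m * p.length := add_le_add hq₁ hq₂
      _ = m * (p.length + 1) := by ring

/-- Bond covers preserve reachability (existence of admissible contours). [folklore] -/
theorem BondCover.reachable (h : BondCover G₁ G₂ φ m) {u v : V₁} (huv : G₁.Reachable u v) :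
    G₂.Reachable (φ u) (φ v) := by
  obtain ⟨p⟩ := huv
  obtain ⟨q, -⟩ := h.exists_walk p
  exact ⟨q⟩

/-- **Lipschitz comparison of the two graph distances**: d₂(φu, φv) ≦ m·d₁(u, v) for u, v joined by an admissible
contour of the first system (push a minimising contour through the cover). [folklore] -/
theorem BondCover.dist_le (h : BondCover G₁ G₂ φ m) {u v : V₁} (huv : G₁.Reachable u v) :
    G₂.dist (φ u) (φ v) ≤ m * G₁.dist u v := by
  obtain ⟨p, hp⟩ := huv.exists_walk_length_eq_dist
  obtain ⟨q, hq⟩ := h.exists_walk p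
  rw [← hp]
  exact (SimpleGraph.dist_le q).trans hq

/-- The same for a connected first system (admissible contours always exist, B6 p. 231 *"Of course the infimum is
attained at some contour"*). [folklore] -/
theorem BondCover.dist_le_of_connected (h : BondCover G₁ G₂ φ m) (hconn : G₁.Connected) (u v : V₁) :
    G₂.dist (φ u) (φ v) ≤ m * G₁.dist u v :=
  h.dist_le (hconn u v)

/-- Bond covers compose; the constants multiply. [folklore] -/
theorem BondCover.comp {G₃ : SimpleGraph V₃} {ψ : V₂ → V₃} {n : ℕ} (hφ : BondCover G₁ G₂ φ m)
    (hψ : BondCover G₂ G₃ ψ n) : BondCover G₁ G₃ (ψ ∘ φ) (n * m) := by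
  refine ⟨fun u v huv => ?_⟩
  obtain ⟨q, hq⟩ := hφ.cover huv
  obtain ⟨r, hr⟩ := hψ.exists_walk q
  exact ⟨r, hr.trans (Nat.mul_le_mul_left n hq)⟩

/-- **Potential bound** (the shape of the first inequality of B6 (2.48), d(y, y′) ≧ (L^jη)^{−1}|y − y₁| + …, for a
contour inside one zone): a map f of the points into a metric space stretching every admissible bond by at most K
stretches the end-points of a contour of n bonds by at most K·n, dist(f u, f v) ≦ K·n.
[cite: Balaban1984PropagatorsII, (2.48) p.232] -/
theorem dist_map_le_mul_length {X : Type*} [PseudoMetricSpace X] {G : SimpleGraph V₁} {f : V₁ → X} {K : ℝ}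
    (hf : ∀ ⦃u v : V₁⦄, G.Adj u v → dist (f u) (f v) ≤ K) {u v : V₁} (p : G.Walk u v) :
    dist (f u) (f v) ≤ K * p.length := by
  induction p with
  | nil => simp
  | @cons a b c hab p ih =>
    rw [SimpleGraph.Walk.length_cons, Nat.cast_add, Nat.cast_one, mul_add, mul_one]
    calc dist (f a) (f c) ≤ dist (f a) (f b) + dist (f b) (f c) := dist_triangle _ _ _
      _ ≤ K + K * (p.length : ℝ) := add_le_add (hf hab) ih
      _ = K * (p.length : ℝ) + K := add_comm _ _

/-- The same against the graph distance: dist(f u, f v) ≦ K·d(u, v) for u, v joined by an admissible contour.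
[cite: Balaban1984PropagatorsII, (2.48) p.232] -/
theorem dist_map_le_mul_dist {X : Type*} [PseudoMetricSpace X] {G : SimpleGraph V₁} {f : V₁ → X} {K : ℝ}
    (hf : ∀ ⦃u v : V₁⦄, G.Adj u v → dist (f u) (f v) ≤ K) {u v : V₁} (huv : G.Reachable u v) :
    dist (f u) (f v) ≤ K * G.dist u v := by
  obtain ⟨p, hp⟩ := huv.exists_walk_length_eq_dist
  rw [← hp]
  exact dist_map_le_mul_length hf p

end Graph

/-! ## §2  Site level, carrier-free: two distances realised by two contour systems [(2.46)] -/

section Sites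

variable {S₁ S₂ V₁ V₂ : Type*} {dist₁ : S₁ → S₁ → ℝ} {dist₂ : S₂ → S₂ → ℝ} {G₁ : SimpleGraph V₁}
  {G₂ : SimpleGraph V₂} {ι₁ : S₁ → V₁} {ι₂ : S₂ → V₂} {φ : V₁ → V₂} {m : ℕ}

/-- **d₂(y, y′) ≦ m·d₁(a, b)** for two distances (2.46) realised by contour systems (G₁, ι₁), (G₂, ι₂), a bond cover
φ with constant m, block points a, b joined by an admissible contour of the first system, and φ ι₁ a = ι₂ y,
φ ι₁ b = ι₂ y′. [cite: Balaban1984PropagatorsII, (2.46) p.231; Balaban1985BackgroundPropagators, p.409 + p.411] -/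
theorem dist_le_mul_of_bondCover (h₁ : B6Geometry.RealizedBy dist₁ G₁ ι₁) (h₂ : B6Geometry.RealizedBy dist₂ G₂ ι₂)
    (hcov : BondCover G₁ G₂ φ m) {a b : S₁} (hreach : G₁.Reachable (ι₁ a) (ι₁ b)) {y y' : S₂}
    (ha : φ (ι₁ a) = ι₂ y) (hb : φ (ι₁ b) = ι₂ y') :
    dist₂ y y' ≤ m * dist₁ a b := by
  rw [h₁ a b, h₂ y y', ← ha, ← hb]
  exact_mod_cast hcov.dist_le hreach

/-- **(1/m)·d₂(y, y′) ≦ d₁(a, b)** — the same in the rate form used downstream (m = 0: by d₁ ≧ 0, junk-free).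
[cite: Balaban1984PropagatorsII, (2.46) p.231; Balaban1985BackgroundPropagators, p.409 + p.411] -/
theorem inv_mul_dist_le_of_bondCover (h₁ : B6Geometry.RealizedBy dist₁ G₁ ι₁)
    (h₂ : B6Geometry.RealizedBy dist₂ G₂ ι₂) (hcov : BondCover G₁ G₂ φ m) {a b : S₁}
    (hreach : G₁.Reachable (ι₁ a) (ι₁ b)) {y y' : S₂} (ha : φ (ι₁ a) = ι₂ y) (hb : φ (ι₁ b) = ι₂ y') :
    (m : ℝ)⁻¹ * dist₂ y y' ≤ dist₁ a b := by
  rcases Nat.eq_zero_or_pos m with rfl | hm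
  · rw [Nat.cast_zero, inv_zero, zero_mul]
    exact h₁.dist_nonneg a b
  · have hle := dist_le_mul_of_bondCover h₁ h₂ hcov hreach ha hb
    have hm' : (m : ℝ) ≠ 0 := Nat.cast_ne_zero.mpr hm.ne'
    calc (m : ℝ)⁻¹ * dist₂ y y' ≤ (m : ℝ)⁻¹ * (m * dist₁ a b) :=
          mul_le_mul_of_nonneg_left hle (inv_nonneg.mpr (Nat.cast_nonneg m))
      _ = dist₁ a b := inv_mul_cancel_left₀ hm' _

/-- **m = 1: d₂(y, y′) ≦ d₁(a, b)** (the first system maps into the second bond-to-bond-or-point, e.g. by a graph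
homomorphism). [cite: Balaban1984PropagatorsII, (2.46) p.231] -/
theorem dist_le_of_bondCover_one (h₁ : B6Geometry.RealizedBy dist₁ G₁ ι₁) (h₂ : B6Geometry.RealizedBy dist₂ G₂ ι₂)
    (hcov : BondCover G₁ G₂ φ 1) {a b : S₁} (hreach : G₁.Reachable (ι₁ a) (ι₁ b)) {y y' : S₂}
    (ha : φ (ι₁ a) = ι₂ y) (hb : φ (ι₁ b) = ι₂ y') :
    dist₂ y y' ≤ dist₁ a b := by
  simpa using dist_le_mul_of_bondCover h₁ h₂ hcov hreach ha hb

/-! ## §3  The hypothesis `hdist` of `B9Eq395Transport.localizedExp_transport`, c := 1/m -/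

/-- **The `hdist` hypothesis of `B9Eq395Transport.localizedExp_transport`** (with `dist₁ := g₁.dist`,
`dist₂ := g₂.dist`, `c := (m : ℝ)⁻¹`): if the local and the global block distances are the distances (2.46) of two
contour systems, the block points are mutually reachable in the local bond graph, φ is a bond cover with constant m,
and φ is compatible with the two embeddings e₁, e₂ of the block lattices into the common index set (agreement
e₁ a = e₂ y forces φ ι₁ a = ι₂ y), then ∀ a b y y′, e₁ a = e₂ y → e₁ b = e₂ y′ → (1/m)·d₂(y, y′) ≦ d₁(a, b).
The instance (φ, m) for Bałaban's □-local and global systems is NOT asserted (module docstring).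
[cite: Balaban1985BackgroundPropagators, p.409 + p.411 + (3.132) p.422; Balaban1984PropagatorsII, (2.46) p.231] -/
theorem hdist_of_bondCover {X : Type*} (h₁ : B6Geometry.RealizedBy dist₁ G₁ ι₁)
    (h₂ : B6Geometry.RealizedBy dist₂ G₂ ι₂) (hcov : BondCover G₁ G₂ φ m)
    (hreach : ∀ a b : S₁, G₁.Reachable (ι₁ a) (ι₁ b)) {e₁ : S₁ → X} {e₂ : S₂ → X}
    (hcompat : ∀ a y, e₁ a = e₂ y → φ (ι₁ a) = ι₂ y) :
    ∀ a b y y', e₁ a = e₂ y → e₁ b = e₂ y' → (m : ℝ)⁻¹ * dist₂ y y' ≤ dist₁ a b :=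
  fun a b y y' ha hb =>
    inv_mul_dist_le_of_bondCover h₁ h₂ hcov (hreach a b) (hcompat a y ha) (hcompat b y' hb)

/-- The same with the `Connected` hypothesis of `…B6Geometry` on the local bond graph.
[cite: Balaban1985BackgroundPropagators, p.409 + p.411; Balaban1984PropagatorsII, (2.46) p.231] -/
theorem hdist_of_bondCover_connected {X : Type*} (h₁ : B6Geometry.RealizedBy dist₁ G₁ ι₁)
    (h₂ : B6Geometry.RealizedBy dist₂ G₂ ι₂) (hcov : BondCover G₁ G₂ φ m) (hconn : G₁.Connected)
    {e₁ : S₁ → X} {e₂ : S₂ → X} (hcompat : ∀ a y, e₁ a = e₂ y → φ (ι₁ a) = ι₂ y) :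
    ∀ a b y y', e₁ a = e₂ y → e₁ b = e₂ y' → (m : ℝ)⁻¹ * dist₂ y y' ≤ dist₁ a b :=
  hdist_of_bondCover h₁ h₂ hcov (fun a b => hconn (ι₁ a) (ι₁ b)) hcompat

/-- 0 ≦ 1/m: the comparability constant c := (m : ℝ)⁻¹ is admissible wherever a sign condition on c is asked.
[folklore] -/
theorem inv_nat_nonneg (m : ℕ) : (0 : ℝ) ≤ (m : ℝ)⁻¹ :=
  inv_nonneg.mpr (Nat.cast_nonneg m)

end Sites

/-! ## §4  The glued edge: `B9Eq395Transport.localizedExp_transport` with `hdist` discharged by a bond cover -/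

section Edge

open B9Eq395Transport

/-- **Transport of the localized exponential majorant from 𝔅(□) to 𝔅 through a bond cover** (B9 p. 409 *"The
operators constructed for this sequence … satisfy all the inequalities of Theorems 3.1–3.3"* read on 𝔅, p. 411
*"convergent in the weighted supremum norm on 𝔅 appearing in the inequality (3.48)"*): the tree's
`localizedExp_transport` with c := 1/m and its hypothesis `hdist` supplied by `hdist_of_bondCover` — if A on
ℝ^{𝔅(□)} has the majorant 1_S(b)·Θ·e^{−ρδ₀d_□(a,b)} (Θ, ρ, δ₀ ≧ 0), d_□ = g₁.dist and d = g₂.dist are the distances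
(2.46) of two contour systems related by a bond cover φ with constant m compatible with the embeddings e₁, e₂ of
the two block lattices into the common index set, the local block points are mutually reachable, and S is carried
into S′, then the compressed operator has the majorant 1_{S′}(y′)·Θ·e^{−(1/m)ρδ₀d(y,y′)}. The instance (φ, m) for
Bałaban's systems is NOT asserted (module docstring).
[cite: Balaban1985BackgroundPropagators, p.409 + (3.95) p.411 + (3.132) p.422; Balaban1984PropagatorsII, (2.46)
p.231 + (2.85) p.238] -/
theorem localizedExp_transport_of_bondCover {X : Type} {g₁ g₂ : B9.Geometry} [Fintype g₁.Site]
    [DecidableEq g₁.Site] [Fintype g₂.Site] [DecidableEq g₂.Site] [DecidableEq X] {R₁ R₂ : ℝ} {H₁ H₂ : Prop}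
    {e₁ : g₁.Site → X} {e₂ : g₂.Site → X} (he₁ : Function.Injective e₁) (he₂ : Function.Injective e₂)
    (Θ ρ δ₀ : ℝ) (hΘ : 0 ≤ Θ) (hρ : 0 ≤ ρ) (hδ₀ : 0 ≤ δ₀) (S₁ : Finset g₁.Site) (S₂ : Finset g₂.Site)
    (hS : ∀ b y', e₁ b = e₂ y' → b ∈ S₁ → y' ∈ S₂)
    {V₁ V₂ : Type*} {G₁ : SimpleGraph V₁} {G₂ : SimpleGraph V₂} {ι₁ : g₁.Site → V₁} {ι₂ : g₂.Site → V₂}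
    {φ : V₁ → V₂} {m : ℕ}
    (h₁ : B6Geometry.RealizedBy g₁.dist G₁ ι₁) (h₂ : B6Geometry.RealizedBy g₂.dist G₂ ι₂)
    (hcov : BondCover G₁ G₂ φ m) (hreach : ∀ a b, G₁.Reachable (ι₁ a) (ι₁ b))
    (hcompat : ∀ a y, e₁ a = e₂ y → φ (ι₁ a) = ι₂ y)
    {A : Module.End ℝ (g₁.Site → ℝ)}
    (hA : B6RandomWalk.HasMajorant (g := B9Thm34Ext.toB6 g₁ R₁ H₁) (fun x : g₁.Site => x) A
      (fun (a b : g₁.Site) => (if b ∈ S₁ then (1 : ℝ) else 0) * Θ * Real.exp (-(ρ * δ₀ * g₁.dist a b)))) :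
    B6RandomWalk.HasMajorant (g := B9Thm34Ext.toB6 g₂ R₂ H₂) (fun x : g₂.Site => x) (compress e₂ (dilate e₁ A))
      (fun (y y' : g₂.Site) => (if y' ∈ S₂ then (1 : ℝ) else 0) * Θ *
        Real.exp (-((m : ℝ)⁻¹ * (ρ * δ₀) * g₂.dist y y'))) :=
  localizedExp_transport he₁ he₂ Θ ρ δ₀ ((m : ℝ)⁻¹) hΘ hρ hδ₀ S₁ S₂ hS
    (hdist_of_bondCover h₁ h₂ hcov hreach hcompat) hA

end Edge

end Literature.MathematicalPhysics.QuantumFieldTheory.Balaban1983to89.B9SectCDistCompare
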